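import Mathlib
import Literature.Analysis.FluidPDE.VectorCalculus
import Literature.Analysis.FluidPDE.VorticityCalculus
import Literature.Analysis.FluidPDE.WholeSpaceIBP
import Summits.NavierStokesRegularity.NavierStokesRegularity.Theorems.AffineBernoulliAlignedStratumTrivialZeros
import Summits.NavierStokesRegularity.NavierStokesRegularity.Theorems.AffineBernoulliAlignedStratumTrivialFields
import Summits.NavierStokesRegularity.NavierStokesRegularity.Theorems.AffineBernoulliAlignedStratumTrivialCutoff
import Summits.NavierStokesRegularity.NavierStokesRegularity.Theorems.AffineBernoulliAlignedStratumTrivialRadialTest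
import Summits.NavierStokesRegularity.NavierStokesRegularity.Theorems.AffineBernoulliAlignedStratumTrivialTools
import HarnessLib

/-!
# `AffineBernoulli.AlignedStratumTrivial` — Step 1: the aligned vorticity vanishes in the far field
  (route `AffineBernoulli`, item stmt-NavierStokesRegularity-13663, helper file VI)

`AlignedStratum.ratio_eq_zero_of_far`: for `W ∈ C²` divergence free with `‖W y‖ ≤ C(1+‖y‖)⁻¹` and
`curl W × V ≡ 0`, `V y = ½(y − c) + W y`, the ratio `λ = ⟪curl W, V⟫/‖V‖²` vanishes at every
point with `dist y c > ρ₀ = √(2C(1+‖c‖)) + 1` (where `V` points outward).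
PROOF. If `λ(y₀) ≠ 0`, integrate `F = D(gη_ε)[G₁] + g η_ε div G₁` (`∫ F = 0`, helper V) with the
radial test function `g` of helper IV through `y₀`, the cutoff `η_ε` of helper III for
`K = {V = 0} ∩ closedBall c R₁`, and `G₁ = √(λ² + δ²) V` (helper II). Pointwise
`F ≤ −κ₁ 𝟙_{B(y₀,r)} + 4MA 𝟙_{S_ε} + (3/2)δ 𝟙_{closedBall c R₁}` (radial term `≤ 0` as `V` is
outward where `g` varies and `≤ −κ₁` near `y₀`; cutoff term by `‖G₁‖ ≤ A·dist(·,K)`, zero-set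
lemma + Lipschitz; `0 ≤ div G₁ ≤ (3/2)δ`); `δ`, then `ε`, small gives a negative integral.

HONEST FRAMING: a Liouville-type lemma about HYPOTHETICAL self-similar Euler profiles; nothing here
bears on the regularity problem itself.
-/

noncomputable section

set_option linter.dupNamespace false

namespace Summit.NavierStokesRegularity.NavierStokesRegularity.Theorems

open Set Function Filter Topology InnerProductSpace MeasureTheory Metric
open scoped RealInnerProductSpace
open Literature.Analysis.FluidPDE

namespace AlignedStratum

/-- **Step 1 (far field).** Under `W ∈ C²`, `div W = 0`, `‖W y‖ ≤ C(1+‖y‖)⁻¹` and alignment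
`curl W y × (½(y−c) + W y) = 0` for all `y`: the ratio `⟪curl W y₀, V y₀⟫/‖V y₀‖²` vanishes whenever
`dist y₀ c > √(2C(1+‖c‖)) + 1`. -/
theorem ratio_eq_zero_of_far {W : EuclideanSpace ℝ (Fin 3) → EuclideanSpace ℝ (Fin 3)}
    {c : EuclideanSpace ℝ (Fin 3)} {C : ℝ} (hW : ContDiff ℝ 2 W)
    (hdiv : VectorCalculus.IsDivFree W) (hWC : ∀ y, ‖W y‖ ≤ C * (1 + ‖y‖)⁻¹)
    (halign : ∀ y, cross (curl W y) ((1 / 2 : ℝ) • (y - c) + W y) = 0)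
    {y₀ : EuclideanSpace ℝ (Fin 3)} (hy₀ : √(2 * (C * (1 + ‖c‖))) + 1 < dist y₀ c) :
    ⟪curl W y₀, (1 / 2 : ℝ) • (y₀ - c) + W y₀⟫ / ‖(1 / 2 : ℝ) • (y₀ - c) + W y₀‖ ^ 2 = 0 := by
  set V : EuclideanSpace ℝ (Fin 3) → EuclideanSpace ℝ (Fin 3) :=
    fun y => (1 / 2 : ℝ) • (y - c) + W y with hVdef
  set lam : EuclideanSpace ℝ (Fin 3) → ℝ := fun y => ⟪curl W y, V y⟫ / ‖V y‖ ^ 2 with hlamdef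
  set ρ₀ : ℝ := √(2 * (C * (1 + ‖c‖))) + 1 with hρ₀
  show lam y₀ = 0
  by_contra hne
  obtain ⟨hC0, hWb⟩ := decay_consts hWC
  have hWd : Differentiable ℝ W := hW.differentiable (by norm_num)
  have hV2 : ContDiff ℝ 2 V := contDiff_simField hW
  have hV1 : ContDiff ℝ 1 V := hV2.of_le (by norm_num)
  have hVc : Continuous V := hV2.continuous
  have hρ₀pos : 0 < ρ₀ := by positivity
  have hfar : ∀ y, ρ₀ ≤ dist y c → 1 / 2 ≤ ⟪y - c, V y⟫ := fun y hy => half_le_inner_simField hC0 hWC hy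
  have hfarne : ∀ y, ρ₀ ≤ dist y c → V y ≠ 0 := by
    intro y hy hV0
    have := hfar y hy
    rw [hV0, inner_zero_right] at this
    linarith
  have hVy₀ : V y₀ ≠ 0 := hfarne y₀ hy₀.le
  -- facts on `U = {V ≠ 0}`
  have hlamU : ∀ y, V y ≠ 0 → ContDiffAt ℝ 1 lam y := fun y hy => contDiffAt_ratio hW hy
  have hcurlU : ∀ y, V y ≠ 0 → curl W y = lam y • V y := fun y hy => curl_eq_ratio_smul (halign y) hy
  have htrU : ∀ y, V y ≠ 0 → fderiv ℝ lam y (V y) = -(3 / 2) * lam y :=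
    fun y hy => fderiv_ratio_apply_simField hW hdiv halign hy
  have hdivV : ∀ y, VectorCalculus.divergence V y = 3 / 2 := fun y => divergence_simField hWd hdiv y
  -- the radial test function through `y₀`
  obtain ⟨g, β, Z, h, R₁, hg1, hg01, hZ, hh, hR₁, hgR, hgc, hβc, hβ0, hβR, hβ1, hgD⟩ :=
    exists_radialTest c hρ₀pos hy₀
  -- the zero set inside the big ball
  set K : Set (EuclideanSpace ℝ (Fin 3)) := {y | V y = 0 ∧ dist y c ≤ R₁} with hKdef
  have hKc : IsCompact K := by
    have hcl : IsClosed {y : EuclideanSpace ℝ (Fin 3) | V y = 0} := isClosed_eq hVc continuous_const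
    have : K = {y | V y = 0} ∩ closedBall c R₁ := by
      ext y; simp [hKdef, mem_closedBall]
    rw [this]
    exact (isCompact_closedBall c R₁).inter_left hcl
  have hKρ : ∀ k ∈ K, dist k c < ρ₀ := by
    intro k hk
    by_contra h
    exact hfarne k (not_lt.1 h) hk.1
  have hKzero : ∀ k ∈ K, (1 / 2 : ℝ) • (k - c) + W k = 0 ∧ curl W k = 0 :=
    fun k hk => ⟨hk.1, curl_eq_zero_of_simField_eq_zero hW halign hk.1⟩
  obtain ⟨L, hL0, hL⟩ := exists_lipschitz_const hW c R₁
  have hLin : ∀ y, dist y c ≤ R₁ → 0 < infDist y K →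
      ‖curl W y‖ ≤ L * infDist y K ∧ ‖V y‖ ≤ L * infDist y K := fun y hy hpos =>
    norm_le_mul_infDist hKc (fun k hk => hk.2) hKzero hL hy hpos
  -- continuity at `y₀`: the ball `B(y₀, r)`
  set m : ℝ := |lam y₀| / 2 with hmdef
  have hm : 0 < m := by have := abs_pos.2 hne; positivity
  clear_value m
  set gap : ℝ := (dist y₀ c - ρ₀) / 2 with hgapdef
  have hgap : 0 < gap := by rw [hgapdef]; linarith
  clear_value gap
  have hlamc : ContinuousAt lam y₀ := (hlamU y₀ hVy₀).continuousAt
  obtain ⟨r₁, hr₁, hr₁b⟩ := Metric.continuousAt_iff.1 hlamc m hm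
  have hsqc : ContinuousAt (fun y : EuclideanSpace ℝ (Fin 3) => ‖y - c‖ ^ 2) y₀ := by fun_prop
  obtain ⟨r₂, hr₂, hr₂b⟩ := Metric.continuousAt_iff.1 hsqc h hh
  set r : ℝ := min (min r₁ r₂) gap with hrdef
  have hr : 0 < r := by positivity
  have hrr₁ : r ≤ r₁ := (min_le_left _ _).trans (min_le_left _ _)
  have hrr₂ : r ≤ r₂ := (min_le_left _ _).trans (min_le_right _ _)
  have hrgap : r ≤ gap := min_le_right _ _
  clear_value r
  have hball : ∀ y, dist y y₀ < r →
      m ≤ |lam y| ∧ β (‖y - c‖ ^ 2) = 1 ∧ ρ₀ + gap ≤ dist y c := by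
    intro y hy
    have hy1 : dist y y₀ < r₁ := lt_of_lt_of_le hy hrr₁
    have hy2 : dist y y₀ < r₂ := lt_of_lt_of_le hy hrr₂
    have hy3 : dist y y₀ < gap := lt_of_lt_of_le hy hrgap
    refine ⟨?_, ?_, ?_⟩
    · have := hr₁b hy1
      rw [Real.dist_eq] at this
      have h1 : |lam y₀| - |lam y| ≤ |lam y - lam y₀| := by
        have := abs_sub_abs_le_abs_sub (lam y₀) (lam y); rwa [abs_sub_comm] at this
      rw [hmdef]; linarith
    · refine hβ1 _ ?_
      have := hr₂b hy2
      rw [Real.dist_eq] at this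
      rw [dist_eq_norm]
      exact this.le
    · have := dist_triangle y₀ y c
      rw [dist_comm y₀ y] at this
      rw [hgapdef]; linarith
  have hballV : ∀ y, dist y y₀ < r → V y ≠ 0 := fun y hy =>
    hfarne y (by linarith [(hball y hy).2.2])
  have hballK : ∀ y, dist y y₀ < r → ∀ k ∈ K, gap < dist y k := by
    intro y hy k hk
    have h1 := (hball y hy).2.2
    have h2 := hKρ k hk
    have := dist_triangle y k c
    linarith
  obtain ⟨M, hM0, hcut⟩ := exists_cutoff K
  set A : ℝ := L + L with hAdef
  have hA0 : 0 ≤ A := by positivity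
  clear_value A
  set κ₁ : ℝ := m / Z with hκ₁
  have hκ₁pos : 0 < κ₁ := by positivity
  clear_value κ₁
  obtain ⟨vb, hvb⟩ : ∃ vb : ℝ, vb = (volume (ball y₀ r)).toReal := ⟨_, rfl⟩
  have hvb0 : 0 < vb := by
    rw [hvb]
    exact ENNReal.toReal_pos (measure_ball_pos volume y₀ hr).ne' measure_ball_lt_top.ne
  obtain ⟨vB, hvB⟩ : ∃ vB : ℝ, vB = (volume (closedBall c R₁)).toReal := ⟨_, rfl⟩
  have hvB0 : 0 ≤ vB := by rw [hvB]; exact ENNReal.toReal_nonneg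
  -- choice of `δ`
  set δ : ℝ := min 1 (κ₁ * vb / (4 * (3 / 2 * vB + 1))) with hδdef
  have hδ0 : 0 < δ := by positivity
  have hδ1 : δ ≤ 1 := min_le_left _ _
  have hδB : 3 / 2 * δ * vB ≤ κ₁ * vb / 4 := by
    have h1 : δ ≤ κ₁ * vb / (4 * (3 / 2 * vB + 1)) := min_le_right _ _
    have h2 : 3 / 2 * δ * vB ≤ 3 / 2 * (κ₁ * vb / (4 * (3 / 2 * vB + 1))) * vB := by gcongr
    refine h2.trans ?_
    rw [show 3 / 2 * (κ₁ * vb / (4 * (3 / 2 * vB + 1))) * vB =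
      κ₁ * vb / 4 * (3 / 2 * vB / (3 / 2 * vB + 1)) by field_simp]
    have h3 : 3 / 2 * vB / (3 / 2 * vB + 1) ≤ 1 := by
      rw [div_le_one (by positivity)]; linarith
    calc κ₁ * vb / 4 * (3 / 2 * vB / (3 / 2 * vB + 1)) ≤ κ₁ * vb / 4 * 1 := by gcongr
      _ = κ₁ * vb / 4 := mul_one _
  clear_value δ
  -- choice of `ε`
  obtain ⟨ε₁, hε₁, hε₁b⟩ := exists_volume_annulus_le K c R₁ (τ := κ₁ * vb / (4 * (4 * M * A + 1)))
    (by positivity)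
  set ε : ℝ := min ε₁ (gap / 3) with hεdef
  have hε : 0 < ε := by positivity
  have hεε₁ : ε ≤ ε₁ := min_le_left _ _
  have hεgap : ε ≤ gap / 3 := min_le_right _ _
  clear_value ε
  have hεS : 4 * M * A * (volume {y : EuclideanSpace ℝ (Fin 3) |
      dist y c ≤ R₁ ∧ 0 < infDist y K ∧ infDist y K < 4 * ε}).toReal ≤ κ₁ * vb / 4 := by
    have h1 := hε₁b ε hε hεε₁
    calc 4 * M * A * (volume {y : EuclideanSpace ℝ (Fin 3) |
          dist y c ≤ R₁ ∧ 0 < infDist y K ∧ infDist y K < 4 * ε}).toReal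
        ≤ 4 * M * A * (κ₁ * vb / (4 * (4 * M * A + 1))) := by gcongr
      _ = κ₁ * vb / 4 * (4 * M * A / (4 * M * A + 1)) := by field_simp
      _ ≤ κ₁ * vb / 4 * 1 := by
          gcongr; rw [div_le_one (by positivity)]; linarith
      _ = κ₁ * vb / 4 := mul_one _
  -- the cutoff at scale `ε`
  obtain ⟨η, hη1, hη01, hηsupp, hηone, hηD, hηD0⟩ := hcut ε hε
  have hηball : ∀ y, dist y y₀ < r → η y = 1 := by
    intro y hy
    refine hηone y fun k hk => ?_
    have := hballK y hy k hk
    have hε3 : 3 * ε ≤ gap := by linarith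
    linarith
  have hηK : ∀ y, V y = 0 → dist y c ≤ R₁ → η y = 0 := by
    intro y hVy hyc
    by_contra hne'
    have := hηsupp y hne' y ⟨hVy, hyc⟩
    rw [dist_self] at this
    linarith
  -- the test function `ψ = g η` and the field `G₁`
  set ψ : EuclideanSpace ℝ (Fin 3) → ℝ := fun y => g y * η y with hψdef
  have hψ1 : ContDiff ℝ 1 ψ := hg1.mul hη1
  have hψc : HasCompactSupport ψ := hgc.mul_right
  have hψU : tsupport ψ ⊆ {y | V y ≠ 0} := by
    intro y hy hVy
    have hyg : y ∈ tsupport g := tsupport_mul_subset_left hy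
    have hyη : y ∈ tsupport η := tsupport_mul_subset_right hy
    -- `dist y c ≤ R₁` from the support of `g`
    have hyc : dist y c ≤ R₁ := by
      by_contra hlt
      rw [not_le] at hlt
      have hopen : IsOpen {z : EuclideanSpace ℝ (Fin 3) | R₁ < dist z c} :=
        isOpen_lt continuous_const (continuous_id.dist continuous_const)
      have : y ∉ tsupport g := by
        rw [notMem_tsupport_iff_eventuallyEq]
        filter_upwards [hopen.mem_nhds hlt] with z hz
        exact hgR z hz
      exact this hyg
    -- `η` vanishes near `y ∈ K`: contradiction with `y ∈ tsupport η`
    have hyK : y ∈ K := ⟨hVy, hyc⟩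
    have hopen : IsOpen {z : EuclideanSpace ℝ (Fin 3) | dist z y < 3 * ε / 4} :=
      isOpen_lt (continuous_id.dist continuous_const) continuous_const
    have : y ∉ tsupport η := by
      rw [notMem_tsupport_iff_eventuallyEq]
      filter_upwards [hopen.mem_nhds (show dist y y < 3 * ε / 4 by rw [dist_self]; positivity)]
        with z hz
      by_contra hz'
      have := hηsupp z hz' y hyK
      linarith
    exact this hyη
  set G : EuclideanSpace ℝ (Fin 3) → EuclideanSpace ℝ (Fin 3) :=
    fun z => √(lam z ^ 2 + δ ^ 2) • V z with hGdef
  have hGU : ∀ y ∈ {y | V y ≠ 0}, ContDiffAt ℝ 1 G y := fun y hy =>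
    contDiffAt_fieldOne hδ0.ne' (hlamU y hy) hV1.contDiffAt
  -- sizes of `G`
  have hGnorm : ∀ y, ‖G y‖ ≤ ‖curl W y‖ + δ * ‖V y‖ := by
    intro y
    by_cases hVy : V y = 0
    · simp [hGdef, hVy]
    · have h1 := norm_sqrt_sq_add_smul_le hδ0.le (lam y) (V y)
      rw [← hcurlU y hVy] at h1
      exact h1
  have hGA : ∀ y, dist y c ≤ R₁ → 0 < infDist y K → ‖G y‖ ≤ A * infDist y K := by
    intro y hy hpos
    obtain ⟨h1, h2⟩ := hLin y hy hpos
    calc ‖G y‖ ≤ ‖curl W y‖ + δ * ‖V y‖ := hGnorm y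
      _ ≤ L * infDist y K + 1 * (L * infDist y K) := by gcongr
      _ = A * infDist y K := by rw [hAdef]; ring
  -- the majorant `B = f₁ + f₂ + f₃`
  set S : Set (EuclideanSpace ℝ (Fin 3)) :=
    {y | dist y c ≤ R₁ ∧ 0 < infDist y K ∧ infDist y K < 4 * ε} with hSdef
  have hSm : MeasurableSet S := measurableSet_annulus K c R₁ ε
  set f₁ : EuclideanSpace ℝ (Fin 3) → ℝ := fun y =>
    -κ₁ * (ball y₀ r).indicator (fun _ => (1 : ℝ)) y with hf₁
  set f₂ : EuclideanSpace ℝ (Fin 3) → ℝ := fun y => S.indicator (fun _ => 4 * M * A) y with hf₂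
  set f₃ : EuclideanSpace ℝ (Fin 3) → ℝ := fun y =>
    3 / 2 * δ * (closedBall c R₁).indicator (fun _ => (1 : ℝ)) y with hf₃
  set B : EuclideanSpace ℝ (Fin 3) → ℝ := fun y => f₁ y + f₂ y + f₃ y with hBdef
  have hI1 : Integrable ((ball y₀ r).indicator fun _ => (1 : ℝ)) volume :=
    (integrableOn_const (hs := measure_ball_lt_top.ne)).integrable_indicator measurableSet_ball
  have hI2 : Integrable f₂ volume :=
    (integrableOn_const (hs := (volume_annulus_lt_top K c R₁ ε).ne)).integrable_indicator hSm
  have hI3 : Integrable ((closedBall c R₁).indicator fun _ => (1 : ℝ)) volume :=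
    (integrableOn_const (hs := measure_closedBall_lt_top.ne)).integrable_indicator
      measurableSet_closedBall
  have hJ1 : Integrable f₁ volume := hI1.const_mul _
  have hJ3 : Integrable f₃ volume := hI3.const_mul _
  have hJ12 : Integrable (fun y => f₁ y + f₂ y) volume := hJ1.add hI2
  have hBint : Integrable B volume := hJ12.add hJ3
  have hBval : ∫ y, B y = -κ₁ * vb + 4 * M * A * (volume S).toReal + 3 / 2 * δ * vB := by
    have e1 : ∫ y, (f₁ y + f₂ y) + f₃ y = (∫ y, f₁ y + f₂ y) + ∫ y, f₃ y := integral_add hJ12 hJ3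
    have e2 : ∫ y, f₁ y + f₂ y = (∫ y, f₁ y) + ∫ y, f₂ y := integral_add hJ1 hI2
    have e3 : ∫ y, f₁ y = -κ₁ * vb := by
      rw [hf₁, integral_const_mul, integral_indicator_const _ measurableSet_ball, hvb,
        measureReal_def, smul_eq_mul, mul_one]
    have e4 : ∫ y, f₂ y = 4 * M * A * (volume S).toReal := by
      rw [hf₂, integral_indicator_const _ hSm, measureReal_def, smul_eq_mul, mul_comm]
    have e5 : ∫ y, f₃ y = 3 / 2 * δ * vB := by
      rw [hf₃, integral_const_mul, integral_indicator_const _ measurableSet_closedBall, hvB,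
        measureReal_def, smul_eq_mul, mul_one]
    rw [hBdef]
    show ∫ y, (f₁ y + f₂ y) + f₃ y = _
    rw [e1, e2, e3, e4, e5]
  -- nonnegativity of `f₂`, `f₃`, value of `f₁` off the small ball
  have hf₂0 : ∀ y, 0 ≤ f₂ y := fun y => by
    rw [hf₂]; exact Set.indicator_nonneg (fun _ _ => by positivity) y
  have hind3 : ∀ y, 0 ≤ (closedBall c R₁).indicator (fun _ => (1 : ℝ)) y := fun y =>
    Set.indicator_nonneg (fun _ _ => zero_le_one) y
  have hf₃0 : ∀ y, 0 ≤ f₃ y := fun y => by rw [hf₃]; exact mul_nonneg (by positivity) (hind3 y)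
  -- pointwise comparison `F ≤ B`
  have hFB : ∀ y, fderiv ℝ ψ y (G y) + ψ y * VectorCalculus.divergence G y ≤ B y := by
    intro y
    have hψD : fderiv ℝ ψ y = g y • fderiv ℝ η y + η y • fderiv ℝ g y :=
      fderiv_fun_mul (hg1.differentiable one_ne_zero y) (hη1.differentiable one_ne_zero y)
    have hb : g y * fderiv ℝ η y (G y) ≤ f₂ y :=
      (le_abs_self _).trans (by
        have := norm_mul_fderiv_apply_le_indicator (G := G) hε hM0 hA0
          (fun z => by rw [abs_of_nonneg (hg01 z).1]; exact (hg01 z).2) hgR hGA hηD hηD0 y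
        rwa [Real.norm_eq_abs] at this)
    by_cases hVy : V y = 0
    · -- off `U`: everything vanishes
      have hGy : G y = 0 := by simp [hGdef, hVy]
      have hψy : ψ y = 0 := by
        by_cases hyc : dist y c ≤ R₁
        · simp [hψdef, hηK y hVy hyc]
        · simp [hψdef, hgR y (not_le.1 hyc)]
      have hnball : y ∉ ball y₀ r := fun hy => hballV y (mem_ball.1 hy) hVy
      have hf₁y : f₁ y = 0 := by rw [hf₁]; dsimp only; rw [Set.indicator_of_notMem hnball, mul_zero]
      rw [hGy, hψy, map_zero, zero_mul, add_zero, hBdef]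
      dsimp only
      rw [hf₁y, zero_add]
      exact add_nonneg (hf₂0 y) (hf₃0 y)
    -- on `U`
    obtain ⟨hdiv0, hdivle⟩ := divergence_fieldOne_nonneg_le (V := V) hδ0
      ((hlamU y hVy).differentiableAt one_ne_zero) (hV1.differentiable one_ne_zero y) (hdivV y)
      (htrU y hVy)
    -- term (c): `0 ≤ ψ div G ≤ (3/2) δ 𝟙_{closedBall}`
    have hc : ψ y * VectorCalculus.divergence G y ≤ f₃ y := by
      rw [hf₃]; dsimp only
      by_cases hyc : dist y c ≤ R₁
      · rw [Set.indicator_of_mem (mem_closedBall.2 hyc), mul_one]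
        have hψle : ψ y ≤ 1 := by
          have := mul_le_mul (hg01 y).2 (hη01 y).2 (hη01 y).1 zero_le_one
          simpa [hψdef] using this
        have hψ0 : 0 ≤ ψ y := mul_nonneg (hg01 y).1 (hη01 y).1
        calc ψ y * VectorCalculus.divergence G y ≤ 1 * (3 / 2 * δ) :=
              mul_le_mul hψle hdivle hdiv0 zero_le_one
          _ = 3 / 2 * δ := one_mul _
      · have : ψ y = 0 := by simp [hψdef, hgR y (not_le.1 hyc)]
        rw [this, zero_mul]
        exact mul_nonneg (by positivity) (hind3 y)
    -- term (a): the radial term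
    have ha : η y * fderiv ℝ g y (G y) ≤ f₁ y := by
      rw [hf₁]; dsimp only
      rw [hgD y (G y)]
      have hGi : ⟪y - c, G y⟫ = √(lam y ^ 2 + δ ^ 2) * ⟪y - c, V y⟫ := by
        simp only [hGdef, inner_smul_right]
      rw [hGi]
      have hs0 : 0 ≤ √(lam y ^ 2 + δ ^ 2) := Real.sqrt_nonneg _
      by_cases hyb : y ∈ ball y₀ r
      · obtain ⟨hmle, hβy, hfar_y⟩ := hball y (mem_ball.1 hyb)
        rw [Set.indicator_of_mem hyb, mul_one, hηball y (mem_ball.1 hyb), hβy, one_mul]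
        have hin : 1 / 2 ≤ ⟪y - c, V y⟫ := hfar y (by linarith only [hfar_y, hgap])
        have hsm : m ≤ √(lam y ^ 2 + δ ^ 2) := by
          calc m ≤ |lam y| := hmle
            _ = √(lam y ^ 2) := (Real.sqrt_sq_eq_abs _).symm
            _ ≤ √(lam y ^ 2 + δ ^ 2) := Real.sqrt_le_sqrt (le_add_of_nonneg_right (sq_nonneg δ))
        have hprod : m * (1 / 2) ≤ √(lam y ^ 2 + δ ^ 2) * ⟪y - c, V y⟫ :=
          mul_le_mul hsm hin (by norm_num) hs0
        have hZ2 : 0 < 2 / Z := by positivity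
        have h1 : (2 / Z) * (m * (1 / 2)) ≤ (2 / Z) * (√(lam y ^ 2 + δ ^ 2) * ⟪y - c, V y⟫) :=
          mul_le_mul_of_nonneg_left hprod hZ2.le
        have h2 : (2 / Z) * (m * (1 / 2)) = κ₁ := by rw [hκ₁]; ring
        linarith only [h1, h2]
      · rw [Set.indicator_of_notMem hyb, mul_zero]
        -- `β(‖y-c‖²) ⟪y - c, V y⟫ ≥ 0`
        have hβin : 0 ≤ β (‖y - c‖ ^ 2) * ⟪y - c, V y⟫ := by
          by_cases hyρ : ‖y - c‖ ^ 2 ≤ ρ₀ ^ 2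
          · rw [hβR _ hyρ, zero_mul]
          · have hρy : ρ₀ ≤ dist y c := by
              rw [dist_eq_norm]
              by_contra hlt
              exact hyρ (pow_le_pow_left₀ (norm_nonneg _) (not_le.1 hlt).le 2)
            exact mul_nonneg (hβ0 _) (by linarith only [hfar y hρy])
        have hpos : 0 ≤ η y * ((2 / Z) * β (‖y - c‖ ^ 2) * (√(lam y ^ 2 + δ ^ 2) * ⟪y - c, V y⟫)) := by
          have h1 := (hη01 y).1
          have h2 : 0 ≤ (2 / Z) := by positivity
          have h3 : 0 ≤ β (‖y - c‖ ^ 2) * (√(lam y ^ 2 + δ ^ 2) * ⟪y - c, V y⟫) := by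
            rw [show β (‖y - c‖ ^ 2) * (√(lam y ^ 2 + δ ^ 2) * ⟪y - c, V y⟫) =
              √(lam y ^ 2 + δ ^ 2) * (β (‖y - c‖ ^ 2) * ⟪y - c, V y⟫) by ring]
            exact mul_nonneg hs0 hβin
          exact mul_nonneg h1 (by rw [mul_assoc]; exact mul_nonneg h2 h3)
        have heq : η y * (-(2 / Z) * β (‖y - c‖ ^ 2) * (√(lam y ^ 2 + δ ^ 2) * ⟪y - c, V y⟫)) =
            -(η y * ((2 / Z) * β (‖y - c‖ ^ 2) * (√(lam y ^ 2 + δ ^ 2) * ⟪y - c, V y⟫))) := by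
          ring
        rw [heq]
        linarith only [hpos]
    -- assemble
    rw [hψD]
    simp only [_root_.add_apply, _root_.smul_apply, smul_eq_mul]
    rw [hBdef]
    dsimp only
    linarith only [ha, hb, hc]
  -- the divergence identity, integrated against the majorant
  obtain ⟨hFint, hF0⟩ := integral_fderiv_add_mul_divergence (U := {y | V y ≠ 0}) hGU hψ1 hψc hψU
  have hle : ∫ y, (fderiv ℝ ψ y (G y) + ψ y * VectorCalculus.divergence G y) ≤ ∫ y, B y :=
    integral_mono hFint hBint hFB
  rw [hF0, hBval] at hle
  have hkv : 0 < κ₁ * vb := mul_pos hκ₁pos hvb0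
  linarith only [hle, hεS, hδB, hkv]

end AlignedStratum

end Summit.NavierStokesRegularity.NavierStokesRegularity.Theorems
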